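import Mathlib.Probability.Distributions.Gaussian.Multivariate
import Mathlib.Analysis.InnerProductSpace.Adjoint
import HarnessLib

/-!
# Coordinate permutations preserving the covariance preserve the multivariate Gaussian

`Literature/Probability/Distributions/`; a companion of
`Literature/Probability/LatticeModels/LocalPerturbation{Gaussian,Positivity}.lean`: the `μ`-preserving
map `Θ` required by `pertZ_re_pos_of_reflection` (positivity of the perturbed partition function for
reflection-symmetric data), for Gaussian references.  For Mathlib's multivariate Gaussian
`N(m, S)` on `EuclideanSpace ℝ ι` and a permutation `σ` of the coordinates with
`S (σ a) (σ b) = S a b` (and `m ∘ σ = m`):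

* `reindexL σ` — the reindexing isometry `z ↦ z ∘ σ⁻¹` as a continuous linear map, with
  `reindexL_apply : reindexL σ z i = z (σ⁻¹ i)` and adjoint `reindexL σ⁻¹`;
* `covarianceBilin_map_reindexL`: the covariance form of `N(m,S).map (reindexL σ)` is that of `N(m,S)`;
* `map_reindexL_multivariateGaussian`: **`N(m,S).map (reindexL σ) = N(m,S)`** (two Gaussian measures
  with the same mean and covariance form coincide, Mathlib's `IsGaussian.ext`);
* `measurePreserving_reindexL_multivariateGaussian`: the reindexing is measure preserving — e.g. the
  time reflection of a space-time torus acting on a Gaussian field with a reflection-invariant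
  covariance (Glimm–Jaffe, *Quantum Physics*, §6.2, in finite dimensions).

Everything is proved. [folklore]
-/

noncomputable section

open _root_.MeasureTheory _root_.ProbabilityTheory Finset
open scoped BigOperators Matrix

namespace Literature.Probability.Distributions

variable {ι : Type*} [Fintype ι] [DecidableEq ι]

/-- The reindexing isometry `z ↦ z ∘ σ⁻¹` of `EuclideanSpace ℝ ι`, as a continuous linear map.
[folklore] -/
abbrev reindexL (σ : ι ≃ ι) : EuclideanSpace ℝ ι →L[ℝ] EuclideanSpace ℝ ι :=
  (LinearIsometryEquiv.piLpCongrLeft 2 ℝ ℝ σ : EuclideanSpace ℝ ι →L[ℝ] EuclideanSpace ℝ ι)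

omit [DecidableEq ι] in
/-- Coordinates of the reindexed vector: `(reindexL σ z) i = z (σ⁻¹ i)`. [folklore] -/
theorem reindexL_apply (σ : ι ≃ ι) (z : EuclideanSpace ℝ ι) (i : ι) :
    reindexL σ z i = z (σ.symm i) := by
  simp [reindexL, LinearIsometryEquiv.piLpCongrLeft_apply, Equiv.piCongrLeft'_apply]

omit [DecidableEq ι] in
/-- The adjoint of the reindexing isometry is the inverse reindexing. [folklore] -/
theorem adjoint_reindexL (σ : ι ≃ ι) : (reindexL σ).adjoint = reindexL σ.symm := by
  rw [reindexL, LinearIsometryEquiv.adjoint_eq_symm, LinearIsometryEquiv.piLpCongrLeft_symm]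

omit [DecidableEq ι] in
/-- The dot product with `S` is invariant under a permutation preserving `S`. [folklore] -/
theorem dotProduct_mulVec_reindex {S : Matrix ι ι ℝ} (σ : ι ≃ ι)
    (hσ : ∀ a b, S (σ a) (σ b) = S a b) (x y : ι → ℝ) :
    (fun i => x (σ i)) ⬝ᵥ S *ᵥ (fun i => y (σ i)) = x ⬝ᵥ S *ᵥ y := by
  simp only [dotProduct, Matrix.mulVec]
  rw [← Equiv.sum_comp σ (fun a => x a * ∑ b, S a b * y b)]
  refine Finset.sum_congr rfl fun a _ => ?_
  congr 1
  rw [← Equiv.sum_comp σ (fun b => S (σ a) b * y b)]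
  exact Finset.sum_congr rfl fun b _ => by rw [hσ]

/-- **The covariance form is invariant**: for `S` positive semidefinite with `S (σ a) (σ b) = S a b`,
`covarianceBilin (N(m,S).map (reindexL σ)) = covarianceBilin N(m,S)`. [folklore] -/
theorem covarianceBilin_map_reindexL {S : Matrix ι ι ℝ} (hS : S.PosSemidef) (m : EuclideanSpace ℝ ι)
    (σ : ι ≃ ι) (hσ : ∀ a b, S (σ a) (σ b) = S a b) :
    covarianceBilin ((multivariateGaussian m S).map (reindexL σ)) =
      covarianceBilin (multivariateGaussian m S) := by
  ext x y
  rw [covarianceBilin_map IsGaussian.memLp_two_id, adjoint_reindexL,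
    covarianceBilin_multivariateGaussian hS, covarianceBilin_multivariateGaussian hS]
  have hx : (⇑(reindexL σ.symm x) : ι → ℝ) = fun i => x (σ i) := by
    funext i; rw [reindexL_apply]; simp
  have hy : (⇑(reindexL σ.symm y) : ι → ℝ) = fun i => y (σ i) := by
    funext i; rw [reindexL_apply]; simp
  rw [hx, hy]
  exact dotProduct_mulVec_reindex σ hσ _ _

/-- **A coordinate permutation preserving the mean and the covariance preserves `N(m,S)`**:
`N(m,S).map (reindexL σ) = N(m,S)`. [folklore] -/
theorem map_reindexL_multivariateGaussian {S : Matrix ι ι ℝ} (hS : S.PosSemidef)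
    (m : EuclideanSpace ℝ ι) (σ : ι ≃ ι) (hσ : ∀ a b, S (σ a) (σ b) = S a b)
    (hm : reindexL σ m = m) :
    (multivariateGaussian m S).map (reindexL σ) = multivariateGaussian m S := by
  refine IsGaussian.ext ?_ (covarianceBilin_map_reindexL hS m σ hσ)
  show ∫ x, id x ∂_ = ∫ x, id x ∂_
  simp only [id]
  rw [ContinuousLinearMap.integral_id_map IsGaussian.integrable_id, integral_id_multivariateGaussian]
  exact hm

/-- The centred case: `N(0,S).map (reindexL σ) = N(0,S)` when `S (σ a) (σ b) = S a b`. [folklore] -/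
theorem map_reindexL_multivariateGaussian_zero {S : Matrix ι ι ℝ} (hS : S.PosSemidef) (σ : ι ≃ ι)
    (hσ : ∀ a b, S (σ a) (σ b) = S a b) :
    (multivariateGaussian 0 S).map (reindexL σ) = multivariateGaussian 0 S :=
  map_reindexL_multivariateGaussian hS 0 σ hσ (map_zero _)

/-- **The reindexing is measure preserving** for `N(0,S)` with `S (σ a) (σ b) = S a b` — the input
`MeasurePreserving Θ μ μ` of `pertZ_re_pos_of_reflection` for Gaussian references. [folklore] -/
theorem measurePreserving_reindexL_multivariateGaussian {S : Matrix ι ι ℝ} (hS : S.PosSemidef)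
    (σ : ι ≃ ι) (hσ : ∀ a b, S (σ a) (σ b) = S a b) :
    MeasurePreserving (reindexL σ) (multivariateGaussian 0 S) (multivariateGaussian 0 S) :=
  ⟨(reindexL σ).continuous.measurable, map_reindexL_multivariateGaussian_zero hS σ hσ⟩

end Literature.Probability.Distributions
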